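import Summits.CriticalPhenomena.CardyFormulaZ2.Theorems.CardyComplexConeParafermionToSLESixFamiliesDiamondIdentifyAssembly
import HarnessLib

/-!
# Line `potential-darboux-picard-diamond`, stub S4v (`stub_boundaryIdentification`): combinatorics of the boundary chain

Helper file of the stub `stub_boundaryIdentification` of crux `ParafermionToSLESixFamilies` (stmt-CriticalPhenomena-11389).
The boundary chain of a marked diamond (`2π`-periodic injective loop `ℓ` onto `frontier D`, break times
`t 0 = 0 < t 1 < ⋯ < t N = 2π`, affine pieces) decomposes the frontier into the `N` closed segments
`[ℓ(t j), ℓ(t (j+1))]`, `j < N` (`exists_piece_param_of_mem_frontier`). By injectivity of the loop, a point of an open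
piece lies on no other closed piece and a break point `ℓ(t i)` (`1 ≤ i ≤ N`) lies only on the two adjacent closed
pieces `i - 1`, `i` (`not_mem_segment_of_mem_Ioo`, `not_mem_segment_of_break`); since the other pieces form a compact
set, a whole neighbourhood of such a point meets the frontier only inside its own piece, resp. inside the two
adjacent pieces (`frontier_near_piece`, `frontier_near_break`, the registered helper). The two marks are break points
(`exists_break_eq_pt`). These are the facts by which the local analysis of step (v) straightens the boundary.
-/

noncomputable section

namespace Summit.CriticalPhenomena.CardyFormulaZ2.Cruxes.ParafermionToSLESixFamilies.PotentialDarbouxPicardDiamond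

open scoped Topology
open Filter Set Metric Complex
open Literature.Probability.RandomPlanarGeometry

/-! ## The break times -/

/-- The break times are strictly increasing. -/
theorem strictMono_breaks {t : ℕ → ℝ} (htlt : ∀ j, t j < t (j + 1)) : StrictMono t := strictMono_nat_of_lt_succ htlt

/-- `t N = 2π`. -/
theorem break_N {t : ℕ → ℝ} {N : ℕ} (ht0 : t 0 = 0) (htper : ∀ j, t (j + N) = t j + 2 * Real.pi) :
    t N = 2 * Real.pi := by
  have := htper 0; rw [zero_add, ht0, zero_add] at this; exact this

/-- Break times with index `≤ N` lie in `[0, 2π]`. -/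
theorem break_mem_Icc {t : ℕ → ℝ} {N : ℕ} (ht0 : t 0 = 0) (htlt : ∀ j, t j < t (j + 1))
    (htper : ∀ j, t (j + N) = t j + 2 * Real.pi) {j : ℕ} (hj : j ≤ N) : t j ∈ Icc 0 (2 * Real.pi) := by
  have hm := (strictMono_breaks htlt).monotone
  exact ⟨ht0 ▸ hm (Nat.zero_le j), break_N ht0 htper ▸ hm hj⟩

/-- Break points repeat with period `N`. -/
theorem break_point_periodic {ℓ : ℝ → ℂ} {t : ℕ → ℝ} {N : ℕ} (hper : ∀ s : ℝ, ℓ (s + 2 * Real.pi) = ℓ s)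
    (htper : ∀ j, t (j + N) = t j + 2 * Real.pi) (j : ℕ) : ℓ (t (j + N)) = ℓ (t j) := by
  rw [htper, hper]

/-! ## Parametrising the closed pieces -/

/-- A point of the closed piece `j` is `ℓ s` for a parameter `s ∈ [t j, t (j+1)]`. -/
theorem exists_param_of_mem_segment {ℓ : ℝ → ℂ} {t : ℕ → ℝ} (htlt : ∀ j, t j < t (j + 1))
    (haff : ∀ (j : ℕ) (s : ℝ), t j ≤ s → s ≤ t (j + 1) →
      ℓ s = ℓ (t j) + (((s - t j) / (t (j + 1) - t j) : ℝ) : ℂ) * (ℓ (t (j + 1)) - ℓ (t j)))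
    {j : ℕ} {z : ℂ} (hz : z ∈ segment ℝ (ℓ (t j)) (ℓ (t (j + 1)))) :
    ∃ s : ℝ, t j ≤ s ∧ s ≤ t (j + 1) ∧ z = ℓ s := by
  rw [segment_eq_image' ℝ] at hz
  obtain ⟨lam, ⟨h0, h1⟩, rfl⟩ := hz
  have hΔ : 0 < t (j + 1) - t j := by linarith [htlt j]
  refine ⟨t j + lam * (t (j + 1) - t j), by nlinarith, by nlinarith, ?_⟩
  have : (t j + lam * (t (j + 1) - t j) - t j) / (t (j + 1) - t j) = lam := by field_simp; ring
  have hs := haff j (t j + lam * (t (j + 1) - t j)) (by nlinarith) (by nlinarith)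
  rw [this] at hs
  show ℓ (t j) + lam • (ℓ (t (j + 1)) - ℓ (t j)) = _
  rw [hs, real_smul]

/-- A point of the open piece `j` (parameter in `(t j, t (j+1))`) lies in the open segment. -/
theorem mem_openSegment_of_mem_Ioo {ℓ : ℝ → ℂ} {t : ℕ → ℝ}
    (haff : ∀ (j : ℕ) (s : ℝ), t j ≤ s → s ≤ t (j + 1) →
      ℓ s = ℓ (t j) + (((s - t j) / (t (j + 1) - t j) : ℝ) : ℂ) * (ℓ (t (j + 1)) - ℓ (t j)))
    {j : ℕ} {s : ℝ} (hs1 : t j < s) (hs2 : s < t (j + 1)) :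
    ℓ s ∈ openSegment ℝ (ℓ (t j)) (ℓ (t (j + 1))) := by
  rw [openSegment_eq_image' ℝ]
  have hΔ : 0 < t (j + 1) - t j := by linarith
  refine ⟨(s - t j) / (t (j + 1) - t j), ⟨div_pos (by linarith) hΔ, by rw [div_lt_one hΔ]; linarith⟩, ?_⟩
  show ℓ (t j) + ((s - t j) / (t (j + 1) - t j)) • (ℓ (t (j + 1)) - ℓ (t j)) = ℓ s
  rw [haff j s hs1.le hs2.le, real_smul]

/-- A parameter of `[t j, t (j+1)]` gives a point of the closed piece `j`. -/
theorem mem_segment_of_param {ℓ : ℝ → ℂ} {t : ℕ → ℝ} (htlt : ∀ j, t j < t (j + 1))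
    (haff : ∀ (j : ℕ) (s : ℝ), t j ≤ s → s ≤ t (j + 1) →
      ℓ s = ℓ (t j) + (((s - t j) / (t (j + 1) - t j) : ℝ) : ℂ) * (ℓ (t (j + 1)) - ℓ (t j)))
    {j : ℕ} {s : ℝ} (hs1 : t j ≤ s) (hs2 : s ≤ t (j + 1)) :
    ℓ s ∈ segment ℝ (ℓ (t j)) (ℓ (t (j + 1))) := by
  rw [segment_eq_image' ℝ]
  have hΔ : 0 < t (j + 1) - t j := by linarith [htlt j]
  refine ⟨(s - t j) / (t (j + 1) - t j), ⟨div_nonneg (by linarith) hΔ.le, by rw [div_le_one hΔ]; linarith⟩, ?_⟩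
  show ℓ (t j) + ((s - t j) / (t (j + 1) - t j)) • (ℓ (t (j + 1)) - ℓ (t j)) = ℓ s
  rw [haff j s hs1 hs2, real_smul]

/-- **Every frontier point lies on a closed piece of the fundamental period**: `z = ℓ s` with `s ∈ [t j, t (j+1)]`,
`j < N`. -/
theorem exists_piece_param_of_mem_frontier {D : DobrushinDomain} {N : ℕ} {ℓ : ℝ → ℂ} {t : ℕ → ℝ} (hN : 0 < N)
    (hper : ∀ s : ℝ, ℓ (s + 2 * Real.pi) = ℓ s) (hrange : Set.range ℓ = frontier D.carrier) (ht0 : t 0 = 0)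
    (htper : ∀ j, t (j + N) = t j + 2 * Real.pi) {z : ℂ} (hz : z ∈ frontier D.carrier) :
    ∃ (j : ℕ) (s : ℝ), j < N ∧ t j ≤ s ∧ s ≤ t (j + 1) ∧ s < 2 * Real.pi ∧ z = ℓ s := by
  rw [← hrange] at hz
  obtain ⟨s₁, rfl⟩ := hz
  obtain ⟨s₀, hs₀, -, -, hℓ⟩ := loop_reduce (by positivity : (0:ℝ) < 2 * Real.pi) hper s₁
  obtain ⟨j, hj, h1, h2⟩ := exists_piece_of_mem_Ico hN ht0 htper hs₀
  exact ⟨j, s₀, hj, h1, h2, hs₀.2, hℓ.symm⟩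

/-! ## Injectivity of the loop on the closed period -/

/-- Two parameters of `[0, 2π]` with the same image are equal or are the two endpoints. -/
theorem param_eq_of_eq {ℓ : ℝ → ℂ} (hper : ∀ s : ℝ, ℓ (s + 2 * Real.pi) = ℓ s)
    (hinj : Set.InjOn ℓ (Set.Ico 0 (2 * Real.pi))) {s s' : ℝ} (hs : s ∈ Icc 0 (2 * Real.pi))
    (hs' : s' ∈ Icc 0 (2 * Real.pi)) (heq : ℓ s = ℓ s') :
    s = s' ∨ (s = 0 ∧ s' = 2 * Real.pi) ∨ (s = 2 * Real.pi ∧ s' = 0) := by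
  have h2π : (0:ℝ) < 2 * Real.pi := by positivity
  have hℓ2π : ℓ (2 * Real.pi) = ℓ 0 := by rw [← hper 0, zero_add]
  -- reduce both parameters into `[0, 2π)`
  set σ : ℝ → ℝ := fun u => if u = 2 * Real.pi then 0 else u with hσ
  have hσmem : ∀ u ∈ Icc (0:ℝ) (2 * Real.pi), σ u ∈ Ico (0:ℝ) (2 * Real.pi) := by
    intro u hu; simp only [hσ]; split_ifs with h
    · exact ⟨le_rfl, h2π⟩
    · exact ⟨hu.1, lt_of_le_of_ne hu.2 h⟩
  have hσℓ : ∀ u : ℝ, ℓ (σ u) = ℓ u := by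
    intro u; simp only [hσ]; split_ifs with h
    · rw [h, hℓ2π]
    · rfl
  have hσeq : σ s = σ s' := hinj (hσmem s hs) (hσmem s' hs') (by rw [hσℓ, hσℓ, heq])
  simp only [hσ] at hσeq
  split_ifs at hσeq with h1 h2 h2
  · left; rw [h1, h2]
  · right; right; exact ⟨h1, hσeq.symm⟩
  · right; left; exact ⟨hσeq, h2⟩
  · left; exact hσeq

/-- **A point of an open piece lies on no other closed piece of the period.** -/
theorem not_mem_segment_of_mem_Ioo {ℓ : ℝ → ℂ} {t : ℕ → ℝ} {N : ℕ} (hper : ∀ s : ℝ, ℓ (s + 2 * Real.pi) = ℓ s)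
    (hinj : Set.InjOn ℓ (Set.Ico 0 (2 * Real.pi))) (ht0 : t 0 = 0) (htlt : ∀ j, t j < t (j + 1))
    (htper : ∀ j, t (j + N) = t j + 2 * Real.pi)
    (haff : ∀ (j : ℕ) (s : ℝ), t j ≤ s → s ≤ t (j + 1) →
      ℓ s = ℓ (t j) + (((s - t j) / (t (j + 1) - t j) : ℝ) : ℂ) * (ℓ (t (j + 1)) - ℓ (t j)))
    {j k : ℕ} (hj : j < N) (hk : k < N) (hjk : k ≠ j) {s : ℝ} (hs1 : t j < s) (hs2 : s < t (j + 1)) :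
    ℓ s ∉ segment ℝ (ℓ (t k)) (ℓ (t (k + 1))) := by
  intro hmem
  obtain ⟨s', h1, h2, heq⟩ := exists_param_of_mem_segment htlt haff hmem
  have hm := strictMono_breaks htlt
  have htj := break_mem_Icc ht0 htlt htper hj.le
  have htj1 := break_mem_Icc ht0 htlt htper (Nat.succ_le_of_lt hj)
  have htk := break_mem_Icc ht0 htlt htper hk.le
  have htk1 := break_mem_Icc ht0 htlt htper (Nat.succ_le_of_lt hk)
  have hs : s ∈ Icc (0:ℝ) (2 * Real.pi) := ⟨htj.1.trans hs1.le, hs2.le.trans htj1.2⟩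
  have hs' : s' ∈ Icc (0:ℝ) (2 * Real.pi) := ⟨htk.1.trans h1, h2.trans htk1.2⟩
  rcases param_eq_of_eq hper hinj hs hs' heq with h | ⟨h, -⟩ | ⟨h, -⟩
  · -- `s = s'` lies in `(t j, t (j+1)) ∩ [t k, t (k+1)]`, impossible for `k ≠ j`
    subst h
    rcases lt_or_gt_of_ne hjk with hlt | hlt
    · have : t (k + 1) ≤ t j := hm.monotone (Nat.succ_le_of_lt hlt); linarith
    · have : t (j + 1) ≤ t k := hm.monotone (Nat.succ_le_of_lt hlt); linarith
  · rw [h] at hs1; linarith [htj.1]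
  · rw [h] at hs2; linarith [htj1.2]

/-- **A break point lies only on the two adjacent closed pieces**: for `1 ≤ i ≤ N` and `k < N` with `k ≠ i - 1` and
`k ≠ i % N`, `ℓ (t i) ∉ [ℓ (t k), ℓ (t (k+1))]`. -/
theorem not_mem_segment_of_break {ℓ : ℝ → ℂ} {t : ℕ → ℝ} {N : ℕ} (hper : ∀ s : ℝ, ℓ (s + 2 * Real.pi) = ℓ s)
    (hinj : Set.InjOn ℓ (Set.Ico 0 (2 * Real.pi))) (ht0 : t 0 = 0) (htlt : ∀ j, t j < t (j + 1))
    (htper : ∀ j, t (j + N) = t j + 2 * Real.pi)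
    (haff : ∀ (j : ℕ) (s : ℝ), t j ≤ s → s ≤ t (j + 1) →
      ℓ s = ℓ (t j) + (((s - t j) / (t (j + 1) - t j) : ℝ) : ℂ) * (ℓ (t (j + 1)) - ℓ (t j)))
    {i k : ℕ} (hi1 : 1 ≤ i) (hiN : i ≤ N) (hk : k < N) (hk1 : k ≠ i - 1) (hk2 : k ≠ i % N) :
    ℓ (t i) ∉ segment ℝ (ℓ (t k)) (ℓ (t (k + 1))) := by
  intro hmem
  obtain ⟨s', h1, h2, heq⟩ := exists_param_of_mem_segment htlt haff hmem
  have hm := strictMono_breaks htlt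
  have hti := break_mem_Icc ht0 htlt htper hiN
  have htk := break_mem_Icc ht0 htlt htper hk.le
  have htk1 := break_mem_Icc ht0 htlt htper (Nat.succ_le_of_lt hk)
  have hs' : s' ∈ Icc (0:ℝ) (2 * Real.pi) := ⟨htk.1.trans h1, h2.trans htk1.2⟩
  have hti0 : 0 < t i := by rw [← ht0]; exact hm (Nat.lt_of_lt_of_le Nat.zero_lt_one hi1)
  rcases param_eq_of_eq hper hinj hti hs' heq with h | ⟨h, -⟩ | ⟨h, h'⟩
  · -- `t k ≤ t i ≤ t (k+1)` forces `k = i` or `k = i - 1`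
    rw [← h] at h1 h2
    have hki : k ≤ i := hm.le_iff_le.1 h1
    have hik : i ≤ k + 1 := hm.le_iff_le.1 h2
    rcases Nat.lt_or_ge i N with hlt | hge
    · rw [Nat.mod_eq_of_lt hlt] at hk2; omega
    · have : i = N := le_antisymm hiN hge
      omega
  · linarith
  · -- `t i = 2π`, `s' = 0`: then `i = N` and `k = 0 = N % N`
    rw [h'] at h1
    have hk0 : k = 0 := by
      by_contra hne
      have : t 0 < t k := hm (Nat.pos_of_ne_zero hne)
      linarith
    have hiN' : i = N := by
      by_contra hne
      have : t i < t N := hm (lt_of_le_of_ne hiN hne)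
      rw [break_N ht0 htper] at this; linarith
    rw [hiN', Nat.mod_self] at hk2
    exact hk2 hk0

/-! ## Neighbourhoods of boundary points -/

/-- The union of the closed pieces with index in a finite set is closed. -/
theorem isClosed_biUnion_segment {ℓ : ℝ → ℂ} {t : ℕ → ℝ} (S : Finset ℕ) :
    IsClosed (⋃ k ∈ S, segment ℝ (ℓ (t k)) (ℓ (t (k + 1)))) := by
  refine S.finite_toSet.isClosed_biUnion fun k _ => ?_
  have : IsCompact (segment ℝ (ℓ (t k)) (ℓ (t (k + 1)))) := by
    rw [segment_eq_image_lineMap]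
    exact isCompact_Icc.image AffineMap.lineMap_continuous
  exact this.isClosed

/-- **A neighbourhood of a point of an open piece meets the frontier only inside that piece.** -/
theorem frontier_near_piece {D : DobrushinDomain} {N : ℕ} {ℓ : ℝ → ℂ} {t : ℕ → ℝ} (hN : 0 < N)
    (hper : ∀ s : ℝ, ℓ (s + 2 * Real.pi) = ℓ s) (hrange : Set.range ℓ = frontier D.carrier)
    (hinj : Set.InjOn ℓ (Set.Ico 0 (2 * Real.pi))) (ht0 : t 0 = 0) (htlt : ∀ j, t j < t (j + 1))
    (htper : ∀ j, t (j + N) = t j + 2 * Real.pi)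
    (haff : ∀ (j : ℕ) (s : ℝ), t j ≤ s → s ≤ t (j + 1) →
      ℓ s = ℓ (t j) + (((s - t j) / (t (j + 1) - t j) : ℝ) : ℂ) * (ℓ (t (j + 1)) - ℓ (t j)))
    {j : ℕ} (hj : j < N) {s : ℝ} (hs1 : t j < s) (hs2 : s < t (j + 1)) :
    ∃ ρ : ℝ, 0 < ρ ∧ ∀ z ∈ frontier D.carrier, dist z (ℓ s) < ρ → z ∈ segment ℝ (ℓ (t j)) (ℓ (t (j + 1))) := by
  classical
  set R : Set ℂ := ⋃ k ∈ (Finset.range N).filter (fun k => k ≠ j), segment ℝ (ℓ (t k)) (ℓ (t (k + 1))) with hR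
  have hRc : IsClosed R := isClosed_biUnion_segment _
  have hnot : ℓ s ∉ R := by
    simp only [hR, mem_iUnion, Finset.mem_filter, Finset.mem_range, not_exists, exists_prop, not_and, and_imp]
    intro k hk hkj
    exact not_mem_segment_of_mem_Ioo hper hinj ht0 htlt htper haff hj hk hkj hs1 hs2
  obtain ⟨ρ, hρ, hball⟩ := Metric.mem_nhds_iff.1 (hRc.isOpen_compl.mem_nhds hnot)
  refine ⟨ρ, hρ, fun z hz hdist => ?_⟩
  have hzR : z ∉ R := hball (mem_ball.2 hdist)
  obtain ⟨k, s', hk, h1, h2, -, rfl⟩ := exists_piece_param_of_mem_frontier hN hper hrange ht0 htper hz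
  have hmem : ℓ s' ∈ segment ℝ (ℓ (t k)) (ℓ (t (k + 1))) := mem_segment_of_param htlt haff h1 h2
  by_cases hkj : k = j
  · rw [hkj] at hmem; exact hmem
  · exfalso; apply hzR
    simp only [hR, mem_iUnion, Finset.mem_filter, Finset.mem_range, exists_prop]
    exact ⟨k, ⟨hk, hkj⟩, hmem⟩

/-- **A neighbourhood of a break point meets the frontier only inside the two adjacent closed pieces** (registered
helper): for `1 ≤ i ≤ N`, frontier points close to `ℓ (t i)` lie on `[ℓ(t (i-1)), ℓ(t i)] ∪ [ℓ(t i), ℓ(t (i+1))]`. -/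
theorem frontier_near_break : ∀ (D : DobrushinDomain) (N : ℕ) (ℓ : ℝ → ℂ) (t : ℕ → ℝ), 0 < N → (∀ s : ℝ, ℓ (s + 2 * Real.pi) = ℓ s) → Set.range ℓ = frontier D.carrier → Set.InjOn ℓ (Set.Ico 0 (2 * Real.pi)) → t 0 = 0 → (∀ j, t j < t (j + 1)) → (∀ j, t (j + N) = t j + 2 * Real.pi) → (∀ (j : ℕ) (s : ℝ), t j ≤ s → s ≤ t (j + 1) → ℓ s = ℓ (t j) + (((s - t j) / (t (j + 1) - t j) : ℝ) : ℂ) * (ℓ (t (j + 1)) - ℓ (t j))) → ∀ i : ℕ, 1 ≤ i → i ≤ N → ∃ ρ : ℝ, 0 < ρ ∧ ∀ z ∈ frontier D.carrier, dist z (ℓ (t i)) < ρ → z ∈ segment ℝ (ℓ (t (i - 1))) (ℓ (t i)) ∨ z ∈ segment ℝ (ℓ (t i)) (ℓ (t (i + 1))) := by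
  intro D N ℓ t hN hper hrange hinj ht0 htlt htper haff i hi1 hiN
  classical
  set R : Set ℂ := ⋃ k ∈ (Finset.range N).filter (fun k => k ≠ i - 1 ∧ k ≠ i % N),
    segment ℝ (ℓ (t k)) (ℓ (t (k + 1))) with hR
  have hRc : IsClosed R := isClosed_biUnion_segment _
  have hnot : ℓ (t i) ∉ R := by
    simp only [hR, mem_iUnion, Finset.mem_filter, Finset.mem_range, not_exists, exists_prop, not_and, and_imp]
    intro k hk hk1 hk2
    exact not_mem_segment_of_break hper hinj ht0 htlt htper haff hi1 hiN hk hk1 hk2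
  obtain ⟨ρ, hρ, hball⟩ := Metric.mem_nhds_iff.1 (hRc.isOpen_compl.mem_nhds hnot)
  refine ⟨ρ, hρ, fun z hz hdist => ?_⟩
  have hzR : z ∉ R := hball (mem_ball.2 hdist)
  obtain ⟨k, s', hk, h1, h2, -, rfl⟩ := exists_piece_param_of_mem_frontier hN hper hrange ht0 htper hz
  have hmem : ℓ s' ∈ segment ℝ (ℓ (t k)) (ℓ (t (k + 1))) := mem_segment_of_param htlt haff h1 h2
  by_cases hk1 : k = i - 1
  · left
    have : i - 1 + 1 = i := by omega
    rw [hk1, this] at hmem; exact hmem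
  by_cases hk2 : k = i % N
  · right
    rcases Nat.lt_or_ge i N with hlt | hge
    · rw [hk2, Nat.mod_eq_of_lt hlt] at hmem; exact hmem
    · have hiN' : i = N := le_antisymm hiN hge
      rw [hk2, hiN', Nat.mod_self] at hmem
      rw [hiN', show N = 0 + N from (zero_add N).symm, break_point_periodic hper htper 0,
        show 0 + N + 1 = 1 + N by ring, break_point_periodic hper htper 1]
      simpa using hmem
  · exfalso; apply hzR
    simp only [hR, mem_iUnion, Finset.mem_filter, Finset.mem_range, exists_prop]
    exact ⟨k, ⟨hk, hk1, hk2⟩, hmem⟩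

/-! ## The marks are break points -/

/-- **Each mark of the Dobrushin domain is a break point of the chain**: `D.pt m = ℓ (t i)` for some `1 ≤ i ≤ N`
(the marks lie on no open piece, by `IsBdrySegment`). -/
theorem exists_break_eq_pt {D : DobrushinDomain} {N : ℕ} {ℓ : ℝ → ℂ} {t : ℕ → ℝ} (hN : 0 < N)
    (hper : ∀ s : ℝ, ℓ (s + 2 * Real.pi) = ℓ s) (hrange : Set.range ℓ = frontier D.carrier) (ht0 : t 0 = 0)
    (htper : ∀ j, t (j + N) = t j + 2 * Real.pi) (hseg : ∀ j, IsBdrySegment D (ℓ (t j)) (ℓ (t (j + 1))))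
    (haff : ∀ (j : ℕ) (s : ℝ), t j ≤ s → s ≤ t (j + 1) →
      ℓ s = ℓ (t j) + (((s - t j) / (t (j + 1) - t j) : ℝ) : ℂ) * (ℓ (t (j + 1)) - ℓ (t j)))
    (m : Fin 2) : ∃ i : ℕ, 1 ≤ i ∧ i ≤ N ∧ D.pt m = ℓ (t i) := by
  obtain ⟨j, s, hj, h1, h2, -, hs⟩ := exists_piece_param_of_mem_frontier hN hper hrange ht0 htper (D.pt_mem_frontier m)
  rcases h1.lt_or_eq with hlt1 | heq1
  · rcases h2.lt_or_eq with hlt2 | heq2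
    · exfalso
      have hopen := mem_openSegment_of_mem_Ioo haff hlt1 hlt2
      rw [← hs] at hopen
      fin_cases m
      · exact (hseg j).2.2.1 hopen
      · exact (hseg j).2.2.2.1 hopen
    · exact ⟨j + 1, by omega, by omega, by rw [hs, heq2]⟩
  · rcases Nat.eq_zero_or_pos j with hj0 | hjpos
    · refine ⟨N, hN, le_rfl, ?_⟩
      rw [hs, ← heq1, hj0, show N = 0 + N from (zero_add N).symm, break_point_periodic hper htper 0]
    · exact ⟨j, hjpos, hj.le, by rw [hs, heq1]⟩

/-- Distinct break indices in `[1, N]` give distinct break points. -/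
theorem break_index_eq {ℓ : ℝ → ℂ} {t : ℕ → ℝ} {N : ℕ} (hper : ∀ s : ℝ, ℓ (s + 2 * Real.pi) = ℓ s)
    (hinj : Set.InjOn ℓ (Set.Ico 0 (2 * Real.pi))) (ht0 : t 0 = 0) (htlt : ∀ j, t j < t (j + 1))
    (htper : ∀ j, t (j + N) = t j + 2 * Real.pi) {i i' : ℕ} (hi1 : 1 ≤ i) (hiN : i ≤ N) (hi'1 : 1 ≤ i')
    (hi'N : i' ≤ N) (heq : ℓ (t i) = ℓ (t i')) : i = i' := by
  have hm := strictMono_breaks htlt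
  have h0i : 0 < t i := by rw [← ht0]; exact hm (Nat.lt_of_lt_of_le Nat.zero_lt_one hi1)
  have h0i' : 0 < t i' := by rw [← ht0]; exact hm (Nat.lt_of_lt_of_le Nat.zero_lt_one hi'1)
  rcases param_eq_of_eq hper hinj (break_mem_Icc ht0 htlt htper hiN) (break_mem_Icc ht0 htlt htper hi'N) heq with
    h | ⟨h, -⟩ | ⟨-, h⟩
  · exact hm.injective h
  · linarith
  · linarith

end Summit.CriticalPhenomena.CardyFormulaZ2.Cruxes.ParafermionToSLESixFamilies.PotentialDarbouxPicardDiamond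

end
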